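import Summits.CriticalPhenomena.PercolationContinuityZ3.Theorems.PercNearOneGluingNoHeavyQuantFarLayerOnePlusBlock
import HarnessLib

/-!
# QUANT lane R8, front "FAR beyond trees", layer one — a unicyclic graph with ANY NUMBER of pendant two-anchor blocks hanging off it
# (depth-one cacti of two-anchor blocks) satisfies FAR at layer one, unconditionally

builds on p205010 (kernel theorem, internal audit signed; external expert review pending)

Support file (`--supports stmt-CriticalPhenomena-4575`), seat `prim-quant-p1` (gen 19); memo
`run/shared/lean/prim/quant/prim-quant-p1-g19/FOR-LEAD-CACTI.md` §5 (first instalment of the cactus assembly).  Standard axioms; no sorries.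

Blocks are decoupled one at a time (`Block.farLayerOne_twoAnchor_loaded`); the only bookkeeping is that decoupling one block keeps every OTHER block
a well-formed two-anchor block, which holds as soon as the blocks are pairwise vertex-disjoint and no block hangs at a vertex of another
(`Block.Datum.ok_decouple_of_disjoint`) — i.e. all blocks hang on the unicyclic core (depth one).  Deeper cacti need the bundles produced by a
decoupled block to be flattened into hairs first (g18 `Bundle.*`); that is the remaining assembly step (memo §5).

* `Block.Datum` — the data `(c, v₁, v₂, Z, L, par)` of a block; `Block.Datum.OK` — well-formedness w.r.t. weights, relays and observer;
  `Block.decoupleAll` — decouple a list of blocks in turn;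
* **`Block.layerOne_of_pforest_plus_blocks`** — if the blocks are well formed, pairwise disjoint with no block hanging inside another, and the fully
  decoupled weights form a pendant forest on a cycle carrying the relays, then for the ORIGINAL weights and the observer `c₀` on the cycle:
  `2 < Σ_a P(c₀ ↔ a)` and `P(c₀ ↮ a) ≤ t` on `A` imply `P(#{a ∈ A : c₀ ↔ a} ≤ 1) ≤ t`.
[cite: KozmaNitzan2024, Conjecture 3 (p. 15)] (the row); [this work].
-/

noncomputable section

namespace Summit.CriticalPhenomena.PercolationContinuityZ3.Theorems

namespace Quant

namespace Block

open Finset MeasureTheory Set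
open Literature.Probability.LatticeModels
open Literature.Probability.Percolation
open Bundle (avoid)
open scoped Classical

variable {n : ℕ}

/-- The data of a pendant two-anchor block: cut vertex `c`, anchors `v₁, v₂`, vertex set `Z`, leaves `L`, parent map of the leaves. [this work] -/
structure Datum (n : ℕ) where
  /-- the cut vertex -/
  c : Fin n
  /-- first anchor -/
  v₁ : Fin n
  /-- second anchor -/
  v₂ : Fin n
  /-- the block's vertices (without `c`) -/
  Z : Finset (Fin n)
  /-- the leaves -/
  L : Finset (Fin n)
  /-- parent (anchor) of each leaf -/
  par : Fin n → Fin n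

namespace Datum

/-- Well-formedness of a block w.r.t. weights `w`, relay set `A` and observer `o`: two-anchor structure, `o` off the block, the block hangs
at `c` and its leaves at their anchors, the block relays are leaves or anchors, and there is at least one. [this work] -/
structure OK (B : Datum n) (w : Sym2 (Fin n) → unitInterval) (A : Finset (Fin n)) (o : Fin n) : Prop where
  two : IsTwoAnchor B.c B.v₁ B.v₂ B.Z B.L B.par
  obs : o ∉ B.Z
  hangZ : ∀ x y : Fin n, x ≠ y → x ∈ B.Z → y ∉ B.Z → y ≠ B.c → (w s(x, y) : ℝ) = 0
  hangL : ∀ ℓ ∈ B.L, ∀ x : Fin n, x ≠ ℓ → x ≠ B.par ℓ → (w s(ℓ, x) : ℝ) = 0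
  rel : A ∩ B.Z ⊆ B.L ∪ {B.v₁, B.v₂}
  loaded : (A ∩ B.Z).Nonempty

/-- The decoupled weights of one block. [this work] -/
def dec (B : Datum n) (w : Sym2 (Fin n) → unitInterval) : Sym2 (Fin n) → unitInterval := decouple B.c B.v₁ B.v₂ B.Z B.L B.par w

/-- **Decoupling one block keeps a disjoint block (not containing its cut vertex) well formed.** [this work] -/
theorem ok_decouple_of_disjoint {B B' : Datum n} {w : Sym2 (Fin n) → unitInterval} {A : Finset (Fin n)} {o : Fin n}
    (hB : IsTwoAnchor B.c B.v₁ B.v₂ B.Z B.L B.par) (hB' : B'.OK w A o) (hZZ : Disjoint B.Z B'.Z) (hc : B.c ∉ B'.Z) :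
    B'.OK (B.dec w) A o := by
  -- a pair with an end `x ∈ B'.Z` that meets `B.Z` is neither a stem nor a hair of `B`, so its decoupled weight is `0`
  have key : ∀ x y : Fin n, x ∈ B'.Z → (w s(x, y) : ℝ) = 0 → (B.dec w s(x, y) : ℝ) = 0 := by
    intro x y hx hw0
    have hxB : x ∉ B.Z := fun h => Finset.disjoint_left.1 hZZ h hx
    by_cases hav : s(x, y) ∈ avoid B.Z
    · rw [Datum.dec, decouple_of_avoid w hav]; exact hw0
    · -- `y ∈ B.Z`
      have hy : y ∈ B.Z := by
        by_contra hy
        exact hav (Finset.mem_filter.2 ⟨Finset.mem_univ _, fun z hz hmem => by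
          rcases Sym2.mem_iff.1 hmem with rfl | rfl
          · exact hxB hz
          · exact hy hz⟩)
      refine decouple_zero w hav ?_ ?_ ?_
      · intro h
        rcases Sym2.eq_iff.1 h with ⟨h1, -⟩ | ⟨h1, -⟩
        · exact hc (h1 ▸ hx)
        · exact hxB (h1 ▸ hB.v₁Z)
      · intro h
        rcases Sym2.eq_iff.1 h with ⟨h1, -⟩ | ⟨h1, -⟩
        · exact hc (h1 ▸ hx)
        · exact hxB (h1 ▸ hB.v₂Z)
      · rintro ⟨ℓ, hℓ, h⟩
        rcases Sym2.eq_iff.1 h with ⟨h1, -⟩ | ⟨h1, -⟩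
        · exact hxB (h1 ▸ (par_mem hB hℓ).1)
        · exact hxB (h1 ▸ hB.LZ hℓ)
  refine ⟨hB'.two, hB'.obs, ?_, ?_, hB'.rel, hB'.loaded⟩
  · intro x y hxy hx hy hyc
    exact key x y hx (hB'.hangZ x y hxy hx hy hyc)
  · intro ℓ hℓ x hxℓ hxp
    exact key ℓ x (hB'.two.LZ hℓ) (hB'.hangL ℓ hℓ x hxℓ hxp)

end Datum

/-- Decouple a list of blocks in turn (head first). [this work] -/
def decoupleAll : List (Datum n) → (Sym2 (Fin n) → unitInterval) → (Sym2 (Fin n) → unitInterval)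
  | [], w => w
  | B :: rest, w => decoupleAll rest (B.dec w)

variable {Lc : ℕ} {cyc : ℕ → Fin n} {idx : Fin n → ℕ} {T : Finset (Fin n)} {par' : Fin n → Fin n} {dep : Fin n → ℕ}

/-- **FAR at layer one on a unicyclic graph with pendant two-anchor blocks hanging off it (depth one), observer on the cycle.**  The blocks
are well formed for `w`, pairwise vertex-disjoint, no block hangs at a vertex of another, and the fully decoupled weights form a pendant forest on
a cycle with the relays in the forest or on the cycle; then for the ORIGINAL weights: `2 < Σ_{a∈A} P_w(c₀ ↔ a)` and `P_w(c₀ ↮ a) ≤ t` on `A`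
imply `P_w(#{a ∈ A : c₀ ↔ a} ≤ 1) ≤ t`. [this work] -/
theorem layerOne_of_pforest_plus_blocks (A : Finset (Fin n)) (t : ℝ)
    (hA' : ∀ a ∈ A, a ∈ T ∨ ∃ i, i < Lc ∧ a = cyc i) :
    ∀ (blocks : List (Datum n)) (w : Sym2 (Fin n) → unitInterval),
      (∀ B ∈ blocks, B.OK w A (cyc 0)) →
      blocks.Pairwise (fun B B' => Disjoint B.Z B'.Z ∧ B.c ∉ B'.Z) →
      Bundle.PForest Lc cyc idx T par' dep (decoupleAll blocks w) →
      (2 : ℝ) < ∑ a ∈ A, (prodBernoulli w).real (openConn (cyc 0) a) →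
      (∀ a ∈ A, (prodBernoulli w).real (openConn (cyc 0) a : Set (BondConfig (Fin n)))ᶜ ≤ t) →
      (prodBernoulli w).real {ω : BondConfig (Fin n) | (A.filter fun a => ω ∈ openConn (cyc 0) a).card ≤ 1} ≤ t := by
  intro blocks
  induction blocks with
  | nil =>
    intro w _ _ P hEN hcut
    exact Bundle.layerOne_of_pforest_cycleObs P A hA' t hEN hcut
  | cons B rest ih =>
    intro w hOK hpw P hEN hcut
    have hB : B.OK w A (cyc 0) := hOK B (by simp)
    rw [List.pairwise_cons] at hpw
    obtain ⟨hBrest, hrest⟩ := hpw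
    -- the other blocks stay well formed after decoupling `B`
    have hOK' : ∀ B' ∈ rest, B'.OK (B.dec w) A (cyc 0) := fun B' hB' =>
      Datum.ok_decouple_of_disjoint hB.two (hOK B' (List.mem_cons_of_mem _ hB')) (hBrest B' hB').1 (hBrest B' hB').2
    exact farLayerOne_twoAnchor_loaded hB.two w hB.obs hB.hangZ hB.hangL A hB.rel hB.loaded t
      (fun hEN' hcut' => ih (B.dec w) hOK' hrest P hEN' hcut') hEN hcut

end Block

end Quant

end Summit.CriticalPhenomena.PercolationContinuityZ3.Theorems
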